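import Mathlib.Analysis.SpecialFunctions.Pow.Real
import Mathlib.Algebra.Order.Chebyshev
import HarnessLib

/-!
# `NoHeavyLowerTail` (stmt-CriticalPhenomena-4575) — several weak apex attachments never beat the best one (Cauchy–Schwarz mixture bound)

Support file (prover prim-ineq-gen-8 gen 62; `--supports stmt-CriticalPhenomena-4575`; memo
run/shared/lean/prim/prim-ineq-gen-8/FINDING-gen62-BEYONDSP.md §2(a)(ii)).  No definitions, no named facts, no sorries.

When the apex `o` is joined WEAKLY (edge weights `ε·h_i → 0`) to several core vertices `g_i`, the three-point numbers of `(o; u, v)` are, to first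
order in `ε`, SUMS over the attachment points: `p = ε Σ h_i p_i`, `π = ε Σ h_i π_i`, `τ = ε Σ h_i τ_i` (`p_i = P(u ↔ g_i)`, …), while `s = P(u ↔ v)` is
common; so the limiting ratio is `(Σ τ_i)²/((Σ p_i)(Σ π_i)s)`.  This file records the elementary inequality that makes a mixture no better than its
best component:
* **`weak_mixture_le`** — if `τ_i² ≤ C·p_i·π_i` for every `i` (`p_i, π_i, C ≥ 0`), then `(Σ τ_i)² ≤ C·(Σ p_i)·(Σ π_i)` (Cauchy–Schwarz applied to
  `√p_i, √π_i`); with `C = max_i τ_i²/(p_iπ_i)` and the common factor `s`: `DV²(mixture) ≤ max_i DV²(g_i; u, v)`.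
Together with `pendant_E_le` (`…APLPendantExtremal`: for ONE pendant edge only the weak limit and the full attachment matter) this is the rigorous
part of the weak-apex reduction behind the Wheatstone closure constant `C_W ≈ 1.054` (memo §2). [this work]
-/

namespace Summit.CriticalPhenomena.PercolationContinuityZ3.Theorems

namespace APL

/-- **Mixture bound (Cauchy–Schwarz).**  If `τ_i² ≤ C·p_i·π_i` with `p_i, π_i ≥ 0` for all `i ∈ s` and `C ≥ 0`, then
`(Σ_{i∈s} τ_i)² ≤ C·(Σ_{i∈s} p_i)·(Σ_{i∈s} π_i)`.  (A weighted family of three-point configurations sharing the pair `u, v` has mixed ratio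
`(Στ)²/((Σp)(Σπ)s)` at most the largest individual ratio `τ_i²/(p_iπ_i s)`.) [folklore] -/
theorem weak_mixture_le {ι : Type*} (s : Finset ι) (C : ℝ) (hC : 0 ≤ C) (p q τ : ι → ℝ) (hp : ∀ i ∈ s, 0 ≤ p i)
    (hq : ∀ i ∈ s, 0 ≤ q i) (h : ∀ i ∈ s, τ i ^ 2 ≤ C * p i * q i) :
    (∑ i ∈ s, τ i) ^ 2 ≤ C * (∑ i ∈ s, p i) * (∑ i ∈ s, q i) := by
  -- |τ_i| ≤ √C · √p_i · √q_i
  have hroot : ∀ i ∈ s, |τ i| ≤ Real.sqrt C * (Real.sqrt (p i) * Real.sqrt (q i)) := by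
    intro i hi
    rw [← Real.sqrt_mul (hp i hi), ← Real.sqrt_mul hC, ← Real.sqrt_sq_eq_abs]
    exact Real.sqrt_le_sqrt (by rw [← mul_assoc]; exact h i hi)
  have h1 : |∑ i ∈ s, τ i| ≤ Real.sqrt C * ∑ i ∈ s, Real.sqrt (p i) * Real.sqrt (q i) := by
    rw [Finset.mul_sum]
    exact (Finset.abs_sum_le_sum_abs _ _).trans (Finset.sum_le_sum hroot)
  -- Cauchy–Schwarz: (Σ √p √q)² ≤ (Σ p)(Σ q)
  have hcs : (∑ i ∈ s, Real.sqrt (p i) * Real.sqrt (q i)) ^ 2 ≤ (∑ i ∈ s, p i) * (∑ i ∈ s, q i) := by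
    have e1 : ∑ i ∈ s, Real.sqrt (p i) ^ 2 = ∑ i ∈ s, p i := Finset.sum_congr rfl fun i hi => Real.sq_sqrt (hp i hi)
    have e2 : ∑ i ∈ s, Real.sqrt (q i) ^ 2 = ∑ i ∈ s, q i := Finset.sum_congr rfl fun i hi => Real.sq_sqrt (hq i hi)
    rw [← e1, ← e2]
    exact Finset.sum_mul_sq_le_sq_mul_sq s _ _
  have hS : 0 ≤ ∑ i ∈ s, Real.sqrt (p i) * Real.sqrt (q i) :=
    Finset.sum_nonneg fun i _ => mul_nonneg (Real.sqrt_nonneg _) (Real.sqrt_nonneg _)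
  have h2 : (∑ i ∈ s, τ i) ^ 2 ≤ (Real.sqrt C * ∑ i ∈ s, Real.sqrt (p i) * Real.sqrt (q i)) ^ 2 := by
    rw [← sq_abs (∑ i ∈ s, τ i)]
    exact pow_le_pow_left₀ (abs_nonneg _) h1 2
  calc (∑ i ∈ s, τ i) ^ 2 ≤ (Real.sqrt C * ∑ i ∈ s, Real.sqrt (p i) * Real.sqrt (q i)) ^ 2 := h2
    _ = C * (∑ i ∈ s, Real.sqrt (p i) * Real.sqrt (q i)) ^ 2 := by rw [mul_pow, Real.sq_sqrt hC]
    _ ≤ C * ((∑ i ∈ s, p i) * (∑ i ∈ s, q i)) := mul_le_mul_of_nonneg_left hcs hC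
    _ = C * (∑ i ∈ s, p i) * (∑ i ∈ s, q i) := by ring

/-- **The best component dominates the mixture** (ratio form): for `p_i, π_i > 0` on a nonempty `s`,
`(Σ τ_i)² ≤ (max_{i∈s} τ_i²/(p_iπ_i))·(Σ p_i)(Σ π_i)`. [folklore] -/
theorem weak_mixture_le_sup {ι : Type*} (s : Finset ι) (hs : s.Nonempty) (p q τ : ι → ℝ) (hp : ∀ i ∈ s, 0 < p i)
    (hq : ∀ i ∈ s, 0 < q i) :
    (∑ i ∈ s, τ i) ^ 2 ≤ s.sup' hs (fun i => τ i ^ 2 / (p i * q i)) * (∑ i ∈ s, p i) * (∑ i ∈ s, q i) := by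
  obtain ⟨j, hj⟩ := hs
  refine weak_mixture_le s _ ?_ p q τ (fun i hi => (hp i hi).le) (fun i hi => (hq i hi).le) fun i hi => ?_
  · exact le_trans (div_nonneg (sq_nonneg (τ j)) (mul_pos (hp j hj) (hq j hj)).le) (Finset.le_sup' (fun i => τ i ^ 2 / (p i * q i)) hj)
  · have hpq : 0 < p i * q i := mul_pos (hp i hi) (hq i hi)
    have hle : τ i ^ 2 / (p i * q i) ≤ s.sup' ⟨j, hj⟩ (fun i => τ i ^ 2 / (p i * q i)) := Finset.le_sup' (fun i => τ i ^ 2 / (p i * q i)) hi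
    calc τ i ^ 2 = τ i ^ 2 / (p i * q i) * (p i * q i) := by rw [div_mul_cancel₀ _ hpq.ne']
      _ ≤ s.sup' ⟨j, hj⟩ (fun i => τ i ^ 2 / (p i * q i)) * (p i * q i) := mul_le_mul_of_nonneg_right hle hpq.le
      _ = _ := by ring

end APL

end Summit.CriticalPhenomena.PercolationContinuityZ3.Theorems
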